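import Summits.Ventures.PercRepro.RankLevelSetRuleQSmallFlat

/-!
# PercRepro — (R̂) FROM THE SHARP SINGLE-TERM PAIRING: `Π_{l=1}^{k−1} (1 + #P/(u+1+l)) ≤ k`, EVERY `k ≥ 2`
(p4, gen 22; C-044; paper proofs/P4-CELL-THREE.md §11.7)

`rhat_ge_phiK_of_prod (q k m) (2 ≤ k) (k − 1 ≤ q − m) (m ≤ q) (hprod : Π_{i<k−1} (q+2+i) ≤ k·Π_{i<k−1} (q−m+2+i)) :
phiK (q + k) q ≤ rhat q k m` and the matroid form `ruleQRecv_ge_of_flatPart_prod`.  The hypothesis is ONE inequality between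
two products of `k − 1` integers — `Π_{l=1}^{k−1} (1 + m/(u+1+l)) ≤ k` with `u = q − m` — and it is exactly the row `J = 1` of
the single-term pairing of RankLevelSetRuleQSmallFlat (`C(q+J+k−1, J+k−1) ≤ C(u+k, k−1)·C(q+J, J)` with only the
`i = k − 1` term of the diagonal `J + k − 1`): the rows `J ≥ 2` follow from `J = 1` because shifting `J ↦ J + 1` multiplies the
two sides by `(u+m+J+k)/(u+m+J+1)` and `(J+k)/(J+1)`, and `(u+m+J+k)(J+1) ≤ (J+k)(u+m+J+1)` always (`prod_row_step`,
`prod_row_all`).  It strictly contains the small-flat regime `k·m ≤ q + k` (`prod_of_small_flat`: the factorwise bound) —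
numerically it reaches `#P ≈ q/3` at `k = 5` and `≈ q/4` at `k = 8` (thresholds `u₀(m) ≈ 2m … 3m`, paper §11.7), against
`#P ≤ q/k + 1` for the factorwise bound — and asymptotically it is `(k−1)·#P ≲ (u + k/2)·ln k`.  A certified point outside the
small-flat regime: `rhat_hundred_five_thirty : phiK (100 + 5) 100 ≤ rhat 100 5 30` (`k·#P = 150 > 105`;
`102·103·104·105 = 114,725,520 ≤ 5·72·73·74·75 = 145,854,000`).  Axioms: standard.
-/

namespace PercRepro

open Finset

/-- The row-`J` product inequality of the single-term pairing: `Π_{i<r} (u+m+J+1+i)·Π_{i<r} (1+i) ≤ Π_{i<r} (u+2+i)·Π_{i<r} (J+1+i)`.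
The step `J ↦ J + 1`: both products shift by one factor, and `(u+m+J+k)(J+1) ≤ (J+k)(u+m+J+1)`. -/
lemma prod_row_step (u m J r : ℕ) (hJ : 1 ≤ J)
    (h : (∏ i ∈ range r, (u + m + J + 1 + i)) * ∏ i ∈ range r, (1 + i)
        ≤ (∏ i ∈ range r, (u + 2 + i)) * ∏ i ∈ range r, (J + 1 + i)) :
    (∏ i ∈ range r, (u + m + (J + 1) + 1 + i)) * ∏ i ∈ range r, (1 + i)
        ≤ (∏ i ∈ range r, (u + 2 + i)) * ∏ i ∈ range r, (J + 1 + 1 + i) := by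
  have e1 : (∏ i ∈ range r, (u + m + (J + 1) + 1 + i)) * (u + m + J + 1)
      = (∏ i ∈ range r, (u + m + J + 1 + i)) * (u + m + J + 1 + r) := by
    have h1 := Finset.prod_range_succ (fun i => u + m + J + 1 + i) r
    have h2 := Finset.prod_range_succ' (fun i => u + m + J + 1 + i) r
    have h3 : ∏ i ∈ range r, (u + m + J + 1 + (i + 1)) = ∏ i ∈ range r, (u + m + (J + 1) + 1 + i) :=
      Finset.prod_congr rfl (fun i _ => by ring)
    beta_reduce at h1 h2
    rw [h3, add_zero] at h2
    linarith
  have e2 : (∏ i ∈ range r, (J + 1 + 1 + i)) * (J + 1)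
      = (∏ i ∈ range r, (J + 1 + i)) * (J + 1 + r) := by
    have h1 := Finset.prod_range_succ (fun i => J + 1 + i) r
    have h2 := Finset.prod_range_succ' (fun i => J + 1 + i) r
    have h3 : ∏ i ∈ range r, (J + 1 + (i + 1)) = ∏ i ∈ range r, (J + 1 + 1 + i) :=
      Finset.prod_congr rfl (fun i _ => by ring)
    beta_reduce at h1 h2
    rw [h3, add_zero] at h2
    linarith
  have hf : (u + m + J + 1 + r) * (J + 1) ≤ (J + 1 + r) * (u + m + J + 1) := by nlinarith
  have hpos : 0 < (u + m + J + 1) * (J + 1) := by positivity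
  refine Nat.le_of_mul_le_mul_right ?_ hpos
  calc (∏ i ∈ range r, (u + m + (J + 1) + 1 + i)) * (∏ i ∈ range r, (1 + i)) * ((u + m + J + 1) * (J + 1))
      = ((∏ i ∈ range r, (u + m + (J + 1) + 1 + i)) * (u + m + J + 1)) * (∏ i ∈ range r, (1 + i)) * (J + 1) := by
        ring
    _ = (∏ i ∈ range r, (u + m + J + 1 + i)) * (∏ i ∈ range r, (1 + i)) * ((u + m + J + 1 + r) * (J + 1)) := by
        rw [e1]; ring
    _ ≤ (∏ i ∈ range r, (u + 2 + i)) * (∏ i ∈ range r, (J + 1 + i)) * ((J + 1 + r) * (u + m + J + 1)) :=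
        Nat.mul_le_mul h hf
    _ = (∏ i ∈ range r, (u + 2 + i)) * ((∏ i ∈ range r, (J + 1 + i)) * (J + 1 + r)) * (u + m + J + 1) := by ring
    _ = (∏ i ∈ range r, (u + 2 + i)) * (∏ i ∈ range r, (J + 1 + 1 + i)) * ((u + m + J + 1) * (J + 1)) := by
        rw [← e2]; ring

/-- From the row `J = 1` (the hypothesis `Π_{i<r}(u+m+2+i) ≤ (r+1)·Π_{i<r}(u+2+i)`) to every row `J ≥ 1`. -/
lemma prod_row_all (u m r : ℕ)
    (hprod : ∏ i ∈ range r, (u + m + 2 + i) ≤ (r + 1) * ∏ i ∈ range r, (u + 2 + i)) :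
    ∀ J, 1 ≤ J → (∏ i ∈ range r, (u + m + J + 1 + i)) * ∏ i ∈ range r, (1 + i)
        ≤ (∏ i ∈ range r, (u + 2 + i)) * ∏ i ∈ range r, (J + 1 + i) := by
  intro J hJ
  induction J with
  | zero => omega
  | succ J ih =>
    rcases Nat.eq_zero_or_pos J with h0 | hpos
    · subst h0
      -- the base row J = 1: Π(2+i) = (r+1)·Π(1+i)
      have e : ∏ i ∈ range r, (0 + 1 + 1 + i) = (r + 1) * ∏ i ∈ range r, (1 + i) := by
        have h1 := Finset.prod_range_succ (fun i => 1 + i) r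
        have h2 := Finset.prod_range_succ' (fun i => 1 + i) r
        have h3 : ∏ i ∈ range r, (1 + (i + 1)) = ∏ i ∈ range r, (0 + 1 + 1 + i) :=
          Finset.prod_congr rfl (fun i _ => by ring)
        beta_reduce at h1 h2
        rw [h3, add_zero, mul_one] at h2
        rw [show 1 + r = r + 1 by ring] at h1
        linarith
      rw [e, show u + m + (0 + 1) + 1 = u + m + 2 by ring]
      calc (∏ i ∈ range r, (u + m + 2 + i)) * ∏ i ∈ range r, (1 + i)
          ≤ ((r + 1) * ∏ i ∈ range r, (u + 2 + i)) * ∏ i ∈ range r, (1 + i) := Nat.mul_le_mul_right _ hprod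
        _ = (∏ i ∈ range r, (u + 2 + i)) * ((r + 1) * ∏ i ∈ range r, (1 + i)) := by ring
    · exact prod_row_step u m J r hpos (ih hpos)

/-- The termwise pairing inequality in `ℕ` from the product hypothesis (the single-term pairing of
RankLevelSetRuleQSmallFlat with its sharp hypothesis): `C(q+J+k−1, J+k−1) ≤ C(u+k, k−1)·C(q+J, J)`, `q = u + m`, `J ≥ 1`. -/
lemma pairing_choose_of_prod (u m J k : ℕ) (hk : 1 ≤ k)
    (hprod : ∏ i ∈ range (k - 1), (u + m + 2 + i) ≤ k * ∏ i ∈ range (k - 1), (u + 2 + i)) :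
    (u + m + (J + 1) + (k - 1)).choose (J + 1 + (k - 1))
      ≤ (u + 1 + (k - 1)).choose (k - 1) * (u + m + (J + 1)).choose (J + 1) := by
  obtain ⟨r, rfl⟩ : ∃ r, k = r + 1 := ⟨k - 1, by omega⟩
  rw [Nat.add_sub_cancel] at hprod ⊢
  have hA := choose_add_mul_prod (u + m + (J + 1)) (J + 1) r
  have hB := choose_add_mul_prod (u + 1) 0 r
  rw [Nat.choose_zero_right, one_mul, zero_add] at hB
  have hS := prod_row_all u m r hprod (J + 1) (by omega)
  have hprod' : (∏ i ∈ range r, (u + m + (J + 1) + 1 + i)) * ∏ i ∈ range r, (1 + i)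
      ≤ (∏ i ∈ range r, (u + 1 + 1 + i)) * ∏ i ∈ range r, (J + 1 + 1 + i) := by
    simpa only [show ∀ i, u + 1 + 1 + i = u + 2 + i from fun i => by ring] using hS
  have hpos : 0 < (∏ i ∈ range r, (J + 1 + 1 + i)) * ∏ i ∈ range r, (1 + i) := by positivity
  refine le_of_mul_le_mul_right ?_ hpos
  calc (u + m + (J + 1) + r).choose (J + 1 + r) * ((∏ i ∈ range r, (J + 1 + 1 + i)) * ∏ i ∈ range r, (1 + i))
      = ((u + m + (J + 1) + r).choose (J + 1 + r) * ∏ i ∈ range r, (J + 1 + 1 + i)) * ∏ i ∈ range r, (1 + i) := by ring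
    _ = ((u + m + (J + 1)).choose (J + 1) * ∏ i ∈ range r, (u + m + (J + 1) + 1 + i)) * ∏ i ∈ range r, (1 + i) := by
        rw [hA]
    _ = (u + m + (J + 1)).choose (J + 1) * ((∏ i ∈ range r, (u + m + (J + 1) + 1 + i)) * ∏ i ∈ range r, (1 + i)) := by
        ring
    _ ≤ (u + m + (J + 1)).choose (J + 1) * ((∏ i ∈ range r, (u + 1 + 1 + i)) * ∏ i ∈ range r, (J + 1 + 1 + i)) :=
        Nat.mul_le_mul_left _ hprod'
    _ = (u + m + (J + 1)).choose (J + 1) * (((u + 1 + r).choose r * ∏ i ∈ range r, (1 + i)) * ∏ i ∈ range r, (J + 1 + 1 + i)) := by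
        rw [hB]
    _ = (u + 1 + r).choose r * (u + m + (J + 1)).choose (J + 1) * ((∏ i ∈ range r, (J + 1 + 1 + i)) * ∏ i ∈ range r, (1 + i)) := by
        ring

/-- The termwise pairing in `ℚ` from the product hypothesis. -/
lemma pair_term_of_prod (u m k J : ℕ) (hk : 1 ≤ k)
    (hprod : ∏ i ∈ range (k - 1), (u + m + 2 + i) ≤ k * ∏ i ∈ range (k - 1), (u + 2 + i)) :
    (m.choose (J + 1) : ℚ) * (1 / ((u + m + (J + 1)).choose (J + 1) : ℚ))
      ≤ (1 / ((u + m + (k + J)).choose (k + J) : ℚ)) * (((u + k).choose (k - 1) : ℚ) * (m.choose (J + 1) : ℚ)) := by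
  have h := pairing_choose_of_prod u m J k hk hprod
  rw [show u + m + (J + 1) + (k - 1) = u + m + (k + J) by omega, show J + 1 + (k - 1) = k + J by omega,
    show u + 1 + (k - 1) = u + k by omega] at h
  have hX : (0 : ℚ) < ((u + m + (J + 1)).choose (J + 1) : ℚ) := by exact_mod_cast Nat.choose_pos (by omega)
  have hY : (0 : ℚ) < ((u + m + (k + J)).choose (k + J) : ℚ) := by exact_mod_cast Nat.choose_pos (by omega)
  have key : (1 : ℚ) / ((u + m + (J + 1)).choose (J + 1) : ℚ)
      ≤ ((u + k).choose (k - 1) : ℚ) / ((u + m + (k + J)).choose (k + J) : ℚ) := by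
    rw [div_le_div_iff₀ hX hY, one_mul]
    exact_mod_cast h
  calc (m.choose (J + 1) : ℚ) * (1 / ((u + m + (J + 1)).choose (J + 1) : ℚ))
      ≤ (m.choose (J + 1) : ℚ) * (((u + k).choose (k - 1) : ℚ) / ((u + m + (k + J)).choose (k + J) : ℚ)) :=
        mul_le_mul_of_nonneg_left key (by positivity)
    _ = (1 / ((u + m + (k + J)).choose (k + J) : ℚ)) * (((u + k).choose (k - 1) : ℚ) * (m.choose (J + 1) : ℚ)) := by
        ring

/-- **(R̂) FROM THE SHARP SINGLE-TERM PAIRING, EVERY `k ≥ 2`**: if `Π_{i<k−1} (q + 2 + i) ≤ k·Π_{i<k−1} (q − #P + 2 + i)`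
(i.e. `Π_{l=1}^{k−1} (1 + #P/(u + 1 + l)) ≤ k`, `u = q − #P`) and `#P ≤ q − k + 1`, then `Φ(q+k, q) ≤ R̂(q, k, #P)`.
The hypothesis is exactly the row `J = 1` of the single-term pairing; it implies every row `J ≥ 1` (`prod_row_all`) and
contains the small-flat regime `k·#P ≤ q + k` (`prod_of_small_flat`). -/
theorem rhat_ge_phiK_of_prod (q k m : ℕ) (hk : 2 ≤ k) (hu : k - 1 ≤ q - m) (hm : m ≤ q)
    (hprod : ∏ i ∈ range (k - 1), (q + 2 + i) ≤ k * ∏ i ∈ range (k - 1), (q - m + 2 + i)) :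
    phiK (q + k) q ≤ rhat q k m := by
  rw [rhat_ge_phiK_iff_untrunc q k m (by omega) hu hm]
  obtain ⟨u, rfl⟩ : ∃ u, q = u + m := ⟨q - m, by omega⟩
  rw [Nat.add_sub_cancel] at hprod
  -- the i = k − 1 term of every diagonal J' ≥ k
  have hN : ∀ J' ∈ Ico k (k + m),
      (1 / ((u + m + J').choose J' : ℚ)) * (((u + k).choose (k - 1) : ℚ) * (m.choose (J' - (k - 1)) : ℚ))
        ≤ (1 / ((u + m + J').choose J' : ℚ)) * ∑ i ∈ Ioo 0 k,
            (if i ≤ J' ∧ J' - i ≤ m then ((u + m + k - m).choose i : ℚ) * (m.choose (J' - i) : ℚ) else 0) := by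
    intro J' hJ'
    rw [Finset.mem_Ico] at hJ'
    refine mul_le_mul_of_nonneg_left ?_ (by positivity)
    have hmem : k - 1 ∈ Ioo 0 k := by rw [Finset.mem_Ioo]; omega
    refine le_trans ?_ (Finset.single_le_sum (f := fun i =>
      (if i ≤ J' ∧ J' - i ≤ m then ((u + m + k - m).choose i : ℚ) * (m.choose (J' - i) : ℚ) else 0))
      (fun i _ => by split_ifs <;> positivity) hmem)
    rw [if_pos ⟨by omega, by omega⟩, show u + m + k - m = u + k by omega]
  -- the positive side, lower-bounded and re-indexed: J' = k + J, J < m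
  have hpos : ∑ J ∈ range m, (1 / ((u + m + (k + J)).choose (k + J) : ℚ))
        * (((u + k).choose (k - 1) : ℚ) * (m.choose (J + 1) : ℚ))
      ≤ ∑ J' ∈ Ico k (k + m), (1 / ((u + m + J').choose J' : ℚ)) * ∑ i ∈ Ioo 0 k,
            (if i ≤ J' ∧ J' - i ≤ m then ((u + m + k - m).choose i : ℚ) * (m.choose (J' - i) : ℚ) else 0) := by
    refine le_trans (le_of_eq ?_) (Finset.sum_le_sum hN)
    rw [Finset.sum_Ico_eq_sum_range, show k + m - k = m by omega]
    refine Finset.sum_congr rfl (fun J _ => ?_)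
    rw [show k + J - (k - 1) = J + 1 by omega]
  -- the negative side re-indexed: J = J₀ + 1, J₀ < k − 1
  rw [sum_Ioo_nat, show k - (0 + 1) = k - 1 by omega]
  refine le_trans ?_ hpos
  -- termwise f ≤ g, f and g vanish from J ≥ m on
  set f : ℕ → ℚ := fun J => (m.choose (0 + 1 + J) : ℚ) * (1 / ((u + m + (0 + 1 + J)).choose (0 + 1 + J) : ℚ)) with hf
  set g : ℕ → ℚ := fun J => (1 / ((u + m + (k + J)).choose (k + J) : ℚ))
        * (((u + k).choose (k - 1) : ℚ) * (m.choose (J + 1) : ℚ)) with hg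
  have hfg : ∀ J, f J ≤ g J := by
    intro J
    simp only [hf, hg, show 0 + 1 + J = J + 1 by ring]
    exact pair_term_of_prod u m k J (by omega) hprod
  have hg0 : ∀ J, m ≤ J → g J = 0 := by
    intro J hJ
    simp only [hg]
    rw [Nat.choose_eq_zero_of_lt (by omega : m < J + 1)]
    simp
  have hgnn : ∀ J, 0 ≤ g J := by
    intro J
    simp only [hg]
    positivity
  calc ∑ J ∈ range (k - 1), f J ≤ ∑ J ∈ range (k - 1), g J := Finset.sum_le_sum (fun J _ => hfg J)
    _ ≤ ∑ J ∈ range (k - 1 + m), g J :=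
        Finset.sum_le_sum_of_subset_of_nonneg
          (fun x hx => by rw [Finset.mem_range] at hx ⊢; omega) (fun J _ _ => hgnn J)
    _ = ∑ J ∈ range m, g J := by
        rw [← Finset.sum_range_add_sum_Ico _ (show m ≤ k - 1 + m by omega)]
        rw [Finset.sum_eq_zero (fun J hJ => hg0 J (Finset.mem_Ico.1 hJ).1), add_zero]

/-- The small-flat hypothesis `k·m ≤ u + m + k` implies the product hypothesis (factorwise, `pairing_factor` at `J = 1`). -/
lemma prod_of_small_flat (u m k : ℕ) (hk : 1 ≤ k) (hkm : k * m ≤ u + m + k) :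
    ∏ i ∈ range (k - 1), (u + m + 2 + i) ≤ k * ∏ i ∈ range (k - 1), (u + 2 + i) := by
  obtain ⟨r, rfl⟩ : ∃ r, k = r + 1 := ⟨k - 1, by omega⟩
  rw [Nat.add_sub_cancel]
  have hf : (∏ i ∈ range r, (u + m + 2 + i)) * ∏ i ∈ range r, (1 + i)
      ≤ (∏ i ∈ range r, (u + 2 + i)) * ∏ i ∈ range r, (2 + i) := by
    rw [← Finset.prod_mul_distrib, ← Finset.prod_mul_distrib]
    refine Finset.prod_le_prod' (fun i hi => ?_)
    rw [Finset.mem_range] at hi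
    have := pairing_factor u m 1 i (r + 1) (le_refl 1) (by omega) hkm
    calc (u + m + 2 + i) * (1 + i) = (u + m + 1 + (i + 1)) * (i + 1) := by ring
      _ ≤ (u + 1 + (i + 1)) * (1 + (i + 1)) := this
      _ = (u + 2 + i) * (2 + i) := by ring
  have e : ∏ i ∈ range r, (2 + i) = (r + 1) * ∏ i ∈ range r, (1 + i) := by
    have h1 := Finset.prod_range_succ (fun i => 1 + i) r
    have h2 := Finset.prod_range_succ' (fun i => 1 + i) r
    have h3 : ∏ i ∈ range r, (1 + (i + 1)) = ∏ i ∈ range r, (2 + i) := Finset.prod_congr rfl (fun i _ => by ring)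
    beta_reduce at h1 h2
    rw [h3, add_zero, mul_one] at h2
    rw [show 1 + r = r + 1 by ring] at h1
    linarith
  rw [e] at hf
  have hpos : 0 < ∏ i ∈ range r, (1 + i) := by positivity
  refine Nat.le_of_mul_le_mul_right ?_ hpos
  calc (∏ i ∈ range r, (u + m + 2 + i)) * ∏ i ∈ range r, (1 + i)
      ≤ (∏ i ∈ range r, (u + 2 + i)) * ((r + 1) * ∏ i ∈ range r, (1 + i)) := hf
    _ = (r + 1) * (∏ i ∈ range r, (u + 2 + i)) * ∏ i ∈ range r, (1 + i) := by ring

variable {α : Type} (M : Matroid α) [M.Finite]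

/-- **Rule Q pays `Φ(q+k, q)` to every member whose flat part satisfies the sharp single-term condition**
`Π_{i<k−1} (q + 2 + i) ≤ k·Π_{i<k−1} (q − #P + 2 + i)` (and `#P ≤ q − k + 1`), every `k ≥ 2`. -/
theorem ruleQRecv_ge_of_flatPart_prod {q k : ℕ} (hk : 2 ≤ k) (hE : M.E.ncard = (q + k) + q)
    {Z : Set α} (hZ : Z ∈ cellMembers M (q + k) q) (hu : k - 1 ≤ q - (flatPart M Z).ncard)
    (hprod : ∏ i ∈ range (k - 1), (q + 2 + i) ≤ k * ∏ i ∈ range (k - 1), (q - (flatPart M Z).ncard + 2 + i)) :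
    phiK (q + k) q ≤ ruleQRecv M (q + k) q Z := by
  refine le_trans ?_ (rhat_le_ruleQRecv M hE hZ)
  have hm : (flatPart M Z).ncard ≤ q :=
    (Nat.lt_of_sub_pos (lt_of_lt_of_le (show 0 < k - 1 by omega) hu)).le
  exact rhat_ge_phiK_of_prod q k _ hk hu hm hprod


/-- A certified point outside the small-flat regime: `#P = 30` of the cell `(105, 100)` (`k = 5`, `u = 70`). -/
theorem rhat_hundred_five_thirty : phiK (100 + 5) 100 ≤ rhat 100 5 30 :=
  rhat_ge_phiK_of_prod 100 5 30 (by norm_num) (by norm_num) (by norm_num) (by decide)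

end PercRepro
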